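import Summits.QuantumFields.YangMills.Theorems.BalabanUVNodesN11Thm1PrintedFailsAtThm1CWitness
import Literature.MathematicalPhysics.QuantumFieldTheory.Balaban1983to89.Node00.Record13NumericsOfThm1CC1

/-!
# DAG node N11 — THE SAME AT THE C¹-ROUTE WITNESS `θ₁₅ᶜᶜ¹ = theta13OfThm1CC1 F 2 ε₀ ε₂₉ B₃ B₃′ a₀ a₁` (node00-def-K0a's K0⁗∕K0⁵ witness family of record,
# `εreg = a₀`): for `a₀` in [B7] Prop. 2's range, `L² ≤ B₃`, `0 ≤ B₃′`, `0 < a₁`, the §2 form of `ρ₁`, N11's node conclusion, `B16.Thm1Printed` along windowed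
# runs and the pair «`EndStatementBPrinted` ∧ window» of K1⁗'s body ALL FAIL at `θ := θ₁₅ᶜᶜ¹` (referee dag-ref-H PLACEMENT-21 (3): «the class contains BOTH families»)

Cell `pub-ymgap`, YM-PLAN Track A (HUMAN RULING D-0062), seat `pub-ymgap-dag-n11-e` (g7; R134 N11 [B14], strategy s3 «𝐑-operation side»), item K1⁗ `StabilityBAtRecordR13Sep`
= stmt-QuantumFields-20290.  [III] = [Balaban1988Convergent], [15] = [Balaban1985Variational], [B7] = [Balaban1985Averaging], [B16] = [Balaban1989LargeFieldII].
The `θ₁₅ᶜ` file `…N11Thm1PrintedFailsAtThm1CWitness` (p511868) VERBATIM at node00-def-K0a's `Node00/Record13NumericsOfThm1CC1` (`numerics_thm1CC1_of_inInterval`,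
`mul_A0OfThm1CC1_le`, `A0OfThm1CC1_pos`, the `rfl` faces `theta13OfThm1CC1_εreg ∕ _cR ∕ _τ9_M ∕ _M₁ ∕ _A₁`); the live-selector ∕ residual clauses by
`Node00.hasResidualsOfRecord_theta13OfThm1CC1` and this lineage's `liveRepin₁₃_liveSel`; the generic negatives are `…N11LiveRecordFirstLevelFails`'s
`not_sLaw₁₃_one_su2_of_liveSel_of_small_εreg` (one-line composition with seat dag-n11-d's source-agnostic positivity).

WHAT THIS FILE PROVES (0 `sorry`, 0 `def`; group of record `SU(2)`).  §1 `three_mul_side_le_sideχ_theta13OfThm1CC1` (the grid letter at `M₁ = M₂ = 1`, seat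
dag-n11-d's `three_mul_side_le_sideχ_theta13OfThm1C` at the C¹ numerics).  §2 ★★★ `not_sLaw₁₃_one_theta13OfThm1CC1` ∕ `not_densitiesDescribed_leavesP_theta13OfThm1CC1`
∕ `not_smallCouplings_of_b14_main_leavesP_theta13OfThm1CC1` on every run with `0 < K` meeting the first-step letters.  §3 ★ `firstStepLetters_theta13OfThm1CC1_of_inInterval`
— the letters HOLD along every windowed run below `min ½ (A₀ᶜᶜ¹∕8)` (`L² ≤ B₃`).  §4 ★★★ `not_thm1Printed_theta13OfThm1CC1_of_window` (+ core form) and ★★★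
`not_endStatementBPrinted_and_window_theta13OfThm1CC1` (+ `_d4`): the last two conjuncts of K1⁗'s ∃-body are jointly false at `θ := θ₁₅ᶜᶜ¹`.

HONEST FRAMING.  Count-neutral kernel bookkeeping; nothing of Bałaban's asserted or refuted; K1⁗ («∃ θ …») NOT refuted — its witness class excludes `θ₁₅ᶜᶜ¹` at
print-like `a₀` until the 12a-side weight-family re-pin (director-ym №145∕№146 RULING 2); N11 NOT discharged.  One finite four-torus at fixed `ε = L^{−K}`; NOT
ℝ⁴ ∕ OS ∕ mass gap ∕ Clay.  Sources: [III] (2.4)–(2.5) p.255, (2.10)–(2.12) p.256, (3.3) p.265, Thm 1 p.262, (3.25) p.270; [15] Thm 1 (7)–(10) p.279; [B7]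
Prop. 2 (52)–(54) p.26; [B16] Thm 1 + (0.1) pp.355–356.
-/

noncomputable section

open MeasureTheory
open scoped BigOperators Matrix.Norms.L2Operator

namespace Summit.QuantumFields.YangMills.Theorems.BalabanUVNodesN11Thm1PrintedFailsAtThm1CC1Witness

open Literature.MathematicalPhysics.QuantumFieldTheory.Balaban1983to89 T4Continuum Node00 Node00.Tk DagBinding
open Literature.MathematicalPhysics.QuantumFieldTheory.Balaban1983to89.ExpMeanLog (deltaSU)
open Literature.MathematicalPhysics.QuantumFieldTheory.Balaban1983to89.B16RLeafRecord13AtLive (liveRepin₁₃_liveSel)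
open Literature.MathematicalPhysics.QuantumFieldTheory.Balaban1983to89.B16RLeafRecord13LiveRstep (rOperation_leavesP_of_liveSel₁₃_of_hasResiduals)
open Literature.MathematicalPhysics.QuantumFieldTheory.Balaban1983to89.B16RLeafRecord13LiveSLaw (densitiesDescribed_leavesP_iff_sLaw₁₃_all)
open B14.Eq213MaximalDomains (side)
open Summit.QuantumFields.YangMills.Theorems.BalabanUVNodesN11AllLargeFieldLabel (RkOfRecord_pos)
open Summit.QuantumFields.YangMills.BalabanUVNodes.N07Thm1ScaledInterfaceInstance (eta_one_sq eta_one_sq_le_one)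
open Literature.MathematicalPhysics.QuantumFieldTheory.Balaban1983to89.B11Thm1LevelZero (eta_zero)
open Summit.QuantumFields.YangMills.Theorems.BalabanUVNodesN11LiveRecordFirstLevelFails (not_sLaw₁₃_one_su2_of_liveSel_of_small_εreg)
open Summit.QuantumFields.YangMills.Theorems.BalabanUVNodesN11Thm1PrintedFailsAtThm1CWitness (deltaOfRecord_le_of_le_half eta_one_sq_pos range_hyps_of_d4)

variable {F : T4Family} (ε₀ ε₂₉ B₃ B₃' a₀ a₁ : ℝ) (p : B12.RunParams)

/-! ## §1. The grid letter at `θ₁₅ᶜᶜ¹` (`M₁ = M₂ = 1`, `L ≥ 12`, `R₁ ≥ 1`) -/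

/-- **`3·L·M₁ ≤ sideχ` AT `θ₁₅ᶜᶜ¹`** (seat dag-n11-d's `three_mul_side_le_sideχ_theta13OfThm1C` at the C¹ numerics: `M₁ = M₂ = 1`, `sideχ = L²·R₁ ≥ L² ≥ 3L`).
[cite: Balaban1988Convergent, (2.5) p.255, (3.5) p.265 (bookkeeping numerals)] -/
theorem three_mul_side_le_sideχ_theta13OfThm1CC1 {N : ℕ} [NeZero N] :
    3 * side (F.P p.K).L (theta13OfThm1CC1 F N ε₀ ε₂₉ B₃ B₃' a₀ a₁).ν.M₁ 1 ≤
      sideχ F (theta13OfThm1CC1 F N ε₀ ε₂₉ B₃ B₃' a₀ a₁).ν p (gOfRecord₁₃ F N (theta13OfThm1CC1 F N ε₀ ε₂₉ B₃ B₃' a₀ a₁) p) 0 := by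
  have hL : 12 ≤ (F.P p.K).L := by rw [T4Family.P_L]; exact F.hL11
  have hR := RkOfRecord_pos (F.P p.K).L_pos (theta13OfThm1CC1 F N ε₀ ε₂₉ B₃ B₃' a₀ a₁).ν.r
    (gOfRecord₁₃ F N (theta13OfThm1CC1 F N ε₀ ε₂₉ B₃ B₃' a₀ a₁) p (0 + 1))
  show 3 * ((F.P p.K).L ^ 1 * 1) ≤ (F.P p.K).L ^ (0 + 1 + 1) * 1 *
    RkOfRecord (F.P p.K).L (theta13OfThm1CC1 F N ε₀ ε₂₉ B₃ B₃' a₀ a₁).ν.r (gOfRecord₁₃ F N (theta13OfThm1CC1 F N ε₀ ε₂₉ B₃ B₃' a₀ a₁) p (0 + 1))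
  calc 3 * ((F.P p.K).L ^ 1 * 1) = 3 * (F.P p.K).L * 1 := by ring
    _ ≤ (F.P p.K).L * (F.P p.K).L * RkOfRecord (F.P p.K).L (theta13OfThm1CC1 F N ε₀ ε₂₉ B₃ B₃' a₀ a₁).ν.r
          (gOfRecord₁₃ F N (theta13OfThm1CC1 F N ε₀ ε₂₉ B₃ B₃' a₀ a₁) p (0 + 1)) :=
        Nat.mul_le_mul (Nat.mul_le_mul_right _ (by omega)) hR
    _ = (F.P p.K).L ^ (0 + 1 + 1) * 1 * RkOfRecord (F.P p.K).L (theta13OfThm1CC1 F N ε₀ ε₂₉ B₃ B₃' a₀ a₁).ν.r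
          (gOfRecord₁₃ F N (theta13OfThm1CC1 F N ε₀ ε₂₉ B₃ B₃' a₀ a₁) p (0 + 1)) := by ring

/-! ## §2. `¬ SLaw₁₃ … 1`, `¬ densitiesDescribed`, `¬ smallCouplings` at `θ₁₅ᶜᶜ¹` on every run meeting the first-step letters (`SU(2)`) -/

/-- **★★★ `¬ SLaw₁₃ F 2 θ₁₅ᶜᶜ¹ p 1`** for `a₀` in [B7] Prop. 2's range on every run with `0 < K` meeting the first-step letters (`0 < ε₁η₁²`, `ε₀ ≤ a₀η₀²`, `ε₀ ≤ a₀η₁²`,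
`ε₁η₁² + 8δ₀ < 2`): `…LiveRecordFirstLevelFails.not_sLaw₁₃_one_su2_of_liveSel_of_small_εreg` at `θ₁₅ᶜᶜ¹` (`εreg = a₀`, `cR = M = M₁ = M₂ = A₁ = 1` by `rfl`; residuals and
live selector by name; §1's grid letter). [cite: Balaban1988Convergent, Thm 1 p.262, (2.18) p.257, (3.25) p.270, (2.12) p.256, (3.16) p.268; Balaban1989LargeFieldI, (0.3)–(0.4) p.176; Balaban1985Averaging, Prop. 2 (52)–(54) p.26; Balaban1985Variational, Thm 1 p.279 (witness letters only)] -/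
theorem not_sLaw₁₃_one_theta13OfThm1CC1 (hK : 0 < p.K) (ha₀ : 0 < a₀)
    (ha3 : (143 * (((((F.P p.K).d + 4 : ℕ) : ℝ)) ^ 2 / 4) ^ 2) * a₀ ≤ 1 / 3)
    (ha2 : 2 * a₀ ≤ 2 * deltaSU (Fin 2) / ((((F.P p.K).d + 4) * (F.P p.K).L : ℕ) : ℝ) ^ 2)
    (hε₁ : 0 < epsOfRecord (theta13OfThm1CC1 F 2 ε₀ ε₂₉ B₃ B₃' a₀ a₁).ν (gOfRecord₁₃ F 2 (theta13OfThm1CC1 F 2 ε₀ ε₂₉ B₃ B₃' a₀ a₁) p) 1 * (F.P p.K).eta 1 ^ 2)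
    (hc : epsOfRecord (theta13OfThm1CC1 F 2 ε₀ ε₂₉ B₃ B₃' a₀ a₁).ν (gOfRecord₁₃ F 2 (theta13OfThm1CC1 F 2 ε₀ ε₂₉ B₃ B₃' a₀ a₁) p) 0 ≤ a₀ * (F.P p.K).eta 0 ^ 2)
    (hαε : epsOfRecord (theta13OfThm1CC1 F 2 ε₀ ε₂₉ B₃ B₃' a₀ a₁).ν (gOfRecord₁₃ F 2 (theta13OfThm1CC1 F 2 ε₀ ε₂₉ B₃ B₃' a₀ a₁) p) 0 ≤ a₀ * (F.P p.K).eta 1 ^ 2)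
    (hδ : epsOfRecord (theta13OfThm1CC1 F 2 ε₀ ε₂₉ B₃ B₃' a₀ a₁).ν (gOfRecord₁₃ F 2 (theta13OfThm1CC1 F 2 ε₀ ε₂₉ B₃ B₃' a₀ a₁) p) 1 * (F.P p.K).eta 1 ^ 2 +
      4 * (2 * deltaOfRecord (theta13OfThm1CC1 F 2 ε₀ ε₂₉ B₃ B₃' a₀ a₁).ν (gOfRecord₁₃ F 2 (theta13OfThm1CC1 F 2 ε₀ ε₂₉ B₃ B₃' a₀ a₁) p) 0 1) < 2) :
    ¬ SLaw₁₃ F 2 (theta13OfThm1CC1 F 2 ε₀ ε₂₉ B₃ B₃' a₀ a₁) p 1 :=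
  not_sLaw₁₃_one_su2_of_liveSel_of_small_εreg (theta13OfThm1CC1 F 2 ε₀ ε₂₉ B₃ B₃' a₀ a₁) p
    (hasResidualsOfRecord_theta13OfThm1CC1 F 2 ε₀ ε₂₉ B₃ B₃' a₀ a₁)
    (liveRepin₁₃_liveSel F 2 (theta13OfNumerics F 2 (stage12NumericsOfThm1CC1 F.L ε₀ B₃ B₃' a₀ a₁) ε₂₉ _ _ _)) hK
    (by rw [theta13OfThm1CC1_τ9_M]) (by rw [theta13OfThm1CC1_εreg]; exact ha₀) (by rw [theta13OfThm1CC1_εreg]; exact ha3)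
    (by rw [theta13OfThm1CC1_εreg]; exact ha2) (by rw [theta13OfThm1CC1_M₁]) le_rfl
    (three_mul_side_le_sideχ_theta13OfThm1CC1 ε₀ ε₂₉ B₃ B₃' a₀ a₁ p) hε₁
    (by rw [theta13OfThm1CC1_cR, one_mul, theta13OfThm1CC1_εreg]; exact hc) (by rw [theta13OfThm1CC1_cR, one_mul, theta13OfThm1CC1_εreg]; exact hαε)
    (by rw [theta13OfThm1CC1_A₁]; exact hδ)

/-- **★★★ N11's NODE CONCLUSION FAILS AT EVERY WORLD BOUND TO `θ₁₅ᶜᶜ¹`'s C-BINDING** (same hypotheses; whatever datum re-key supplies `C`).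
[cite: Balaban1988Convergent, Thm 1 p.262, (2.18) p.257, (3.25) p.270, (2.12) p.256; Balaban1985Averaging, Prop. 2 (52)–(54) p.26; Balaban1985Variational, Thm 1 p.279 (witness letters only)] -/
theorem not_densitiesDescribed_leavesP_theta13OfThm1CC1 (w : WorldP)
    (hC : w.C = (coreOfRecord₁₃ F 2 (theta13OfThm1CC1 F 2 ε₀ ε₂₉ B₃ B₃' a₀ a₁)).construction (densOfRecord₁₃ F 2 (theta13OfThm1CC1 F 2 ε₀ ε₂₉ B₃ B₃' a₀ a₁)))
    (hK : 0 < p.K) (ha₀ : 0 < a₀)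
    (ha3 : (143 * (((((F.P p.K).d + 4 : ℕ) : ℝ)) ^ 2 / 4) ^ 2) * a₀ ≤ 1 / 3)
    (ha2 : 2 * a₀ ≤ 2 * deltaSU (Fin 2) / ((((F.P p.K).d + 4) * (F.P p.K).L : ℕ) : ℝ) ^ 2)
    (hε₁ : 0 < epsOfRecord (theta13OfThm1CC1 F 2 ε₀ ε₂₉ B₃ B₃' a₀ a₁).ν (gOfRecord₁₃ F 2 (theta13OfThm1CC1 F 2 ε₀ ε₂₉ B₃ B₃' a₀ a₁) p) 1 * (F.P p.K).eta 1 ^ 2)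
    (hc : epsOfRecord (theta13OfThm1CC1 F 2 ε₀ ε₂₉ B₃ B₃' a₀ a₁).ν (gOfRecord₁₃ F 2 (theta13OfThm1CC1 F 2 ε₀ ε₂₉ B₃ B₃' a₀ a₁) p) 0 ≤ a₀ * (F.P p.K).eta 0 ^ 2)
    (hαε : epsOfRecord (theta13OfThm1CC1 F 2 ε₀ ε₂₉ B₃ B₃' a₀ a₁).ν (gOfRecord₁₃ F 2 (theta13OfThm1CC1 F 2 ε₀ ε₂₉ B₃ B₃' a₀ a₁) p) 0 ≤ a₀ * (F.P p.K).eta 1 ^ 2)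
    (hδ : epsOfRecord (theta13OfThm1CC1 F 2 ε₀ ε₂₉ B₃ B₃' a₀ a₁).ν (gOfRecord₁₃ F 2 (theta13OfThm1CC1 F 2 ε₀ ε₂₉ B₃ B₃' a₀ a₁) p) 1 * (F.P p.K).eta 1 ^ 2 +
      4 * (2 * deltaOfRecord (theta13OfThm1CC1 F 2 ε₀ ε₂₉ B₃ B₃' a₀ a₁).ν (gOfRecord₁₃ F 2 (theta13OfThm1CC1 F 2 ε₀ ε₂₉ B₃ B₃' a₀ a₁) p) 0 1) < 2) :
    ¬ (leavesP w p).densitiesDescribed := fun hD =>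
  not_sLaw₁₃_one_theta13OfThm1CC1 ε₀ ε₂₉ B₃ B₃' a₀ a₁ p hK ha₀ ha3 ha2 hε₁ hc hαε hδ
    ((densitiesDescribed_leavesP_iff_sLaw₁₃_all F 2 (theta13OfThm1CC1 F 2 ε₀ ε₂₉ B₃ B₃' a₀ a₁) p w hC).1 hD 1 hK)

/-- `θ₁₅ᶜᶜ¹`'s term constants: `0 ≤ κ`, `0 ≤ E₀`, `0 ≤ B₀` (the family's numerals `κ = 2·10⁴`, `E₀ = B₀ = 1`). [cite: Balaban1988Convergent, (2.28) p.259, (2.31) p.260, (2.42) p.261 (bookkeeping witness)] -/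
theorem lf_signs_theta13OfThm1CC1 {N : ℕ} [NeZero N] :
    0 ≤ (theta13OfThm1CC1 F N ε₀ ε₂₉ B₃ B₃' a₀ a₁).s2.lf.κ ∧ 0 ≤ (theta13OfThm1CC1 F N ε₀ ε₂₉ B₃ B₃' a₀ a₁).s2.lf.E₀ ∧
      0 ≤ (theta13OfThm1CC1 F N ε₀ ε₂₉ B₃ B₃' a₀ a₁).s2.lf.B₀ := by
  have hκ : (theta13OfThm1CC1 F N ε₀ ε₂₉ B₃ B₃' a₀ a₁).s2.lf.κ = 20000 := rfl
  have hE : (theta13OfThm1CC1 F N ε₀ ε₂₉ B₃ B₃' a₀ a₁).s2.lf.E₀ = 1 := rfl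
  have hB : (theta13OfThm1CC1 F N ε₀ ε₂₉ B₃ B₃' a₀ a₁).s2.lf.B₀ = 1 := rfl
  rw [hκ, hE, hB]; norm_num

/-- **★★ A NON-VACUOUS N11 CONJUNCT AT `θ₁₅ᶜᶜ¹`'s WORLDS PUTS THE RUN OUTSIDE THE INTERVAL** (`C` = the construction of record, `up = upOfRecord₅C … θ₁₅ᶜᶜ¹`; the
𝐑-antecedent is this lineage's `rOperation_leavesP_of_liveSel₁₃_of_hasResiduals` from admissibility (`0 < ε₀`, `0 < ε₂₉`, `0 ≤ B₃`, `0 ≤ B₃′`, `0 < a₀`, `0 < a₁`) and the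
term-constant signs). [cite: Balaban1988Convergent, Thm 1 p.262, Theorem p.245, p.244, (3.25) p.270, (2.12) p.256; Balaban1989LargeFieldI, (0.3)–(0.4) p.176; Balaban1985Averaging, Prop. 2 (52)–(54) p.26] -/
theorem not_smallCouplings_of_b14_main_leavesP_theta13OfThm1CC1 (w : WorldP)
    (hC : w.C = (coreOfRecord₁₃ F 2 (theta13OfThm1CC1 F 2 ε₀ ε₂₉ B₃ B₃' a₀ a₁)).construction (densOfRecord₁₃ F 2 (theta13OfThm1CC1 F 2 ε₀ ε₂₉ B₃ B₃' a₀ a₁)))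
    (hup : w.up p = upOfRecord₅C F 2 ((theta13OfThm1CC1 F 2 ε₀ ε₂₉ B₃ B₃' a₀ a₁).toStage5₁₃ F 2) p)
    (hε : 0 < ε₀) (hε' : 0 < ε₂₉) (hB : 0 ≤ B₃) (hB' : 0 ≤ B₃') (ha₀ : 0 < a₀) (ha₁ : 0 < a₁) (hK : 0 < p.K)
    (ha3 : (143 * (((((F.P p.K).d + 4 : ℕ) : ℝ)) ^ 2 / 4) ^ 2) * a₀ ≤ 1 / 3)
    (ha2 : 2 * a₀ ≤ 2 * deltaSU (Fin 2) / ((((F.P p.K).d + 4) * (F.P p.K).L : ℕ) : ℝ) ^ 2)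
    (hε₁ : 0 < epsOfRecord (theta13OfThm1CC1 F 2 ε₀ ε₂₉ B₃ B₃' a₀ a₁).ν (gOfRecord₁₃ F 2 (theta13OfThm1CC1 F 2 ε₀ ε₂₉ B₃ B₃' a₀ a₁) p) 1 * (F.P p.K).eta 1 ^ 2)
    (hc : epsOfRecord (theta13OfThm1CC1 F 2 ε₀ ε₂₉ B₃ B₃' a₀ a₁).ν (gOfRecord₁₃ F 2 (theta13OfThm1CC1 F 2 ε₀ ε₂₉ B₃ B₃' a₀ a₁) p) 0 ≤ a₀ * (F.P p.K).eta 0 ^ 2)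
    (hαε : epsOfRecord (theta13OfThm1CC1 F 2 ε₀ ε₂₉ B₃ B₃' a₀ a₁).ν (gOfRecord₁₃ F 2 (theta13OfThm1CC1 F 2 ε₀ ε₂₉ B₃ B₃' a₀ a₁) p) 0 ≤ a₀ * (F.P p.K).eta 1 ^ 2)
    (hδ : epsOfRecord (theta13OfThm1CC1 F 2 ε₀ ε₂₉ B₃ B₃' a₀ a₁).ν (gOfRecord₁₃ F 2 (theta13OfThm1CC1 F 2 ε₀ ε₂₉ B₃ B₃' a₀ a₁) p) 1 * (F.P p.K).eta 1 ^ 2 +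
      4 * (2 * deltaOfRecord (theta13OfThm1CC1 F 2 ε₀ ε₂₉ B₃ B₃' a₀ a₁).ν (gOfRecord₁₃ F 2 (theta13OfThm1CC1 F 2 ε₀ ε₂₉ B₃ B₃' a₀ a₁) p) 0 1) < 2)
    (h14 : Dag.B14_main (leavesP w p))
    (h7 : (leavesP w p).b7) (h8 : (leavesP w p).b8) (h9 : (leavesP w p).b9) (h10 : (leavesP w p).b10) (h11 : (leavesP w p).b11)
    (hsf : (leavesP w p).smallCouplings → (leavesP w p).smallFieldInductive) (hfc : (leavesP w p).smallCouplings → (leavesP w p).flowControl) :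
    ¬ (leavesP w p).smallCouplings := fun hsc =>
  have hs := lf_signs_theta13OfThm1CC1 (F := F) (N := 2) ε₀ ε₂₉ B₃ B₃' a₀ a₁
  not_densitiesDescribed_leavesP_theta13OfThm1CC1 ε₀ ε₂₉ B₃ B₃' a₀ a₁ p w hC hK ha₀ ha3 ha2 hε₁ hc hαε hδ
    (h14 h7 h8 h9 h10 h11 hsf hfc
      (rOperation_leavesP_of_liveSel₁₃_of_hasResiduals F 2 (theta13OfThm1CC1 F 2 ε₀ ε₂₉ B₃ B₃' a₀ a₁) p w hup
        (hasResidualsOfRecord_theta13OfThm1CC1 F 2 ε₀ ε₂₉ B₃ B₃' a₀ a₁) (admissible_theta13OfThm1CC1 F 2 hε hε' hB hB' ha₀ ha₁)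
        hs.1 hs.2.1 hs.2.2 (liveRepin₁₃_liveSel F 2 (theta13OfNumerics F 2 (stage12NumericsOfThm1CC1 F.L ε₀ B₃ B₃' a₀ a₁) ε₂₉ _ _ _)))
      hsc)

/-! ## §3. THE FIRST-STEP LETTERS AT `θ₁₅ᶜᶜ¹` ALONG A WINDOW BELOW `min ½ (A₀ᶜᶜ¹∕8)` (`L² ≤ B₃`, `0 ≤ B₃′`) -/

/-- **★ THE FOUR FIRST-STEP LETTERS AT `θ₁₅ᶜᶜ¹` ALONG A WINDOWED RUN** (`1 ≤ K`; `γ ≤ ½`, `γ ≤ A₀ᶜᶜ¹∕8`; `0 < a₀, a₁`, `L² ≤ B₃`, `0 ≤ B₃′`) — K0a's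
`numerics_thm1CC1_of_inInterval`, `mul_A0OfThm1CC1_le` and the profile bound `deltaOfRecord_le_of_le_half`.
[cite: Balaban1988Convergent, (2.4)–(2.5) p.255, (2.10)–(2.12) p.256, (3.3) p.265; Balaban1985Variational, Thm 1 (7)–(8) p.279] -/
theorem firstStepLetters_theta13OfThm1CC1_of_inInterval (hB : (F.L : ℝ) ^ 2 ≤ B₃) (hB' : 0 ≤ B₃') (ha₀ : 0 < a₀) (ha₁ : 0 < a₁)
    {γ : ℝ} (hγ2 : γ ≤ 1 / 2) (hγA : γ ≤ A0OfThm1CC1 F.L B₃ B₃' a₀ a₁ / 8) (hK : 1 ≤ p.K)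
    (hw : Step.InInterval γ p.K (gOfRecord₁₃ F 2 (theta13OfThm1CC1 F 2 ε₀ ε₂₉ B₃ B₃' a₀ a₁) p)) :
    0 < epsOfRecord (theta13OfThm1CC1 F 2 ε₀ ε₂₉ B₃ B₃' a₀ a₁).ν (gOfRecord₁₃ F 2 (theta13OfThm1CC1 F 2 ε₀ ε₂₉ B₃ B₃' a₀ a₁) p) 1 * (F.P p.K).eta 1 ^ 2 ∧
    epsOfRecord (theta13OfThm1CC1 F 2 ε₀ ε₂₉ B₃ B₃' a₀ a₁).ν (gOfRecord₁₃ F 2 (theta13OfThm1CC1 F 2 ε₀ ε₂₉ B₃ B₃' a₀ a₁) p) 0 ≤ a₀ * (F.P p.K).eta 0 ^ 2 ∧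
    epsOfRecord (theta13OfThm1CC1 F 2 ε₀ ε₂₉ B₃ B₃' a₀ a₁).ν (gOfRecord₁₃ F 2 (theta13OfThm1CC1 F 2 ε₀ ε₂₉ B₃ B₃' a₀ a₁) p) 0 ≤ a₀ * (F.P p.K).eta 1 ^ 2 ∧
    epsOfRecord (theta13OfThm1CC1 F 2 ε₀ ε₂₉ B₃ B₃' a₀ a₁).ν (gOfRecord₁₃ F 2 (theta13OfThm1CC1 F 2 ε₀ ε₂₉ B₃ B₃' a₀ a₁) p) 1 * (F.P p.K).eta 1 ^ 2 +
      4 * (2 * deltaOfRecord (theta13OfThm1CC1 F 2 ε₀ ε₂₉ B₃ B₃' a₀ a₁).ν (gOfRecord₁₃ F 2 (theta13OfThm1CC1 F 2 ε₀ ε₂₉ B₃ B₃' a₀ a₁) p) 0 1) < 2 := by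
  have hL12 : 12 ≤ F.L := F.hL11
  have hLr : (12 : ℝ) ≤ F.L := by exact_mod_cast hL12
  have hL2 : (144 : ℝ) ≤ (F.L : ℝ) ^ 2 := by nlinarith
  have hB1 : (1 : ℝ) ≤ B₃ := by linarith
  have hB0 : (0 : ℝ) ≤ B₃ := by linarith
  have hA : 0 < A0OfThm1CC1 F.L B₃ B₃' a₀ a₁ := A0OfThm1CC1_pos hB0 hB' ha₀ ha₁
  have hγ1 : γ < 1 := by linarith
  have hν : (theta13OfThm1CC1 F 2 ε₀ ε₂₉ B₃ B₃' a₀ a₁).ν = (stage12NumericsOfThm1CC1 F.L ε₀ B₃ B₃' a₀ a₁).ν := rfl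
  have h0 := numerics_thm1CC1_of_inInterval (L := F.L) (ε₀ := ε₀) hB0 hB' ha₀ ha₁ hγ1 hw 0 (Nat.zero_le _)
  have h1 := numerics_thm1CC1_of_inInterval (L := F.L) (ε₀ := ε₀) hB0 hB' ha₀ ha₁ hγ1 hw 1 hK
  rw [stage12NumericsOfThm1CC1_cR, one_mul, stage12NumericsOfThm1CC1_ν, numerics7OfThm1CC1_εreg] at h0 h1
  rw [hν, stage12NumericsOfThm1CC1_ν]
  obtain ⟨h0pos, -, h0B⟩ := h0
  obtain ⟨h1pos, -, -⟩ := h1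
  set e0 := epsOfRecord (numerics7OfThm1CC1 F.L ε₀ B₃ B₃' a₀ a₁) (gOfRecord₁₃ F 2 (theta13OfThm1CC1 F 2 ε₀ ε₂₉ B₃ B₃' a₀ a₁) p) 0 with he0
  set e1 := epsOfRecord (numerics7OfThm1CC1 F.L ε₀ B₃ B₃' a₀ a₁) (gOfRecord₁₃ F 2 (theta13OfThm1CC1 F 2 ε₀ ε₂₉ B₃ B₃' a₀ a₁) p) 1 with he1
  have hη0 : (F.P p.K).eta 0 = 1 := eta_zero F p.K
  have hη1 : (F.P p.K).eta 1 ^ 2 = 1 / (F.L : ℝ) ^ 2 := eta_one_sq F p.K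
  have hη1pos : 0 < (F.P p.K).eta 1 ^ 2 := eta_one_sq_pos p.K
  have hη1le : (F.P p.K).eta 1 ^ 2 ≤ 1 := eta_one_sq_le_one F p.K
  have hαε : e0 ≤ a₀ * (F.P p.K).eta 1 ^ 2 := by
    rw [hη1, mul_one_div, le_div_iff₀ (by positivity)]
    calc e0 * (F.L : ℝ) ^ 2 ≤ e0 * B₃ := mul_le_mul_of_nonneg_left hB h0pos.le
      _ = B₃ * e0 := by ring
      _ ≤ a₀ := h0B
  have hc : e0 ≤ a₀ * (F.P p.K).eta 0 ^ 2 := by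
    rw [hη0, one_pow, mul_one]
    calc e0 = 1 * e0 := (one_mul _).symm
      _ ≤ B₃ * e0 := mul_le_mul_of_nonneg_right hB1 h0pos.le
      _ ≤ a₀ := h0B
  have he1A : e1 ≤ A0OfThm1CC1 F.L B₃ B₃' a₀ a₁ :=
    epsOfRecord_le_A₀_of_p₀_eq_one (numerics7OfThm1CC1 F.L ε₀ B₃ B₃' a₀ a₁) rfl hA.le (hw 1 hK).1
  have hA16 : A0OfThm1CC1 F.L B₃ B₃' a₀ a₁ ≤ 1 / 16 := by
    have h := mul_A0OfThm1CC1_le (L := F.L) hB0 hB' ha₀.le ha₁.le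
    calc A0OfThm1CC1 F.L B₃ B₃' a₀ a₁ = 1 * A0OfThm1CC1 F.L B₃ B₃' a₀ a₁ := (one_mul _).symm
      _ ≤ B₃ * A0OfThm1CC1 F.L B₃ B₃' a₀ a₁ := mul_le_mul_of_nonneg_right hB1 hA.le
      _ ≤ 1 / 16 := h
  have hterm1 : e1 * (F.P p.K).eta 1 ^ 2 ≤ 1 / 16 :=
    calc e1 * (F.P p.K).eta 1 ^ 2 ≤ e1 * 1 := mul_le_mul_of_nonneg_left hη1le h1pos.le
      _ ≤ 1 / 16 := by rw [mul_one]; exact he1A.trans hA16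
  have hg0 : 0 < gOfRecord₁₃ F 2 (theta13OfThm1CC1 F 2 ε₀ ε₂₉ B₃ B₃' a₀ a₁) p 0 := (hw 0 (Nat.zero_le _)).1
  have hg0le : gOfRecord₁₃ F 2 (theta13OfThm1CC1 F 2 ε₀ ε₂₉ B₃ B₃' a₀ a₁) p 0 ≤ γ := (hw 0 (Nat.zero_le _)).2
  have hδ : deltaOfRecord (numerics7OfThm1CC1 F.L ε₀ B₃ B₃' a₀ a₁) (gOfRecord₁₃ F 2 (theta13OfThm1CC1 F 2 ε₀ ε₂₉ B₃ B₃' a₀ a₁) p) 0 1 ≤ 1 / 8 := by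
    have h := deltaOfRecord_le_of_le_half (numerics7OfThm1CC1 F.L ε₀ B₃ B₃' a₀ a₁) rfl (A₁ := 1) hA zero_le_one hg0 (hg0le.trans hγ2)
    have hA₀ : (numerics7OfThm1CC1 F.L ε₀ B₃ B₃' a₀ a₁).A₀ = A0OfThm1CC1 F.L B₃ B₃' a₀ a₁ := rfl
    rw [hA₀, mul_one] at h
    refine h.trans ?_
    rw [div_le_iff₀ hA]
    linarith
  refine ⟨mul_pos h1pos hη1pos, hc, hαε, ?_⟩
  linarith

/-! ## §4. `B16.Thm1Printed` at `θ₁₅ᶜᶜ¹`'s construction of record is incompatible with the window clause; the last two conjuncts of K1⁗'s body fail there -/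

/-- **★★★ WINDOWED RUNS REFUTE `B16.Thm1Printed` AT `θ₁₅ᶜᶜ¹`'s CONSTRUCTION OF RECORD** (proviso-free; `0 < a₀` in range on every lattice, `0 < a₁`, `L² ≤ B₃`,
`0 ≤ B₃′`). [cite: Balaban1989LargeFieldII, Thm 1 p.355; Balaban1988Convergent, Thm 1 p.262, (2.18) p.257, (3.25) p.270, (2.12) p.256; Balaban1985Averaging, Prop. 2 (52)–(54) p.26; Balaban1985Variational, Thm 1 p.279 (witness letters only)] -/
theorem not_thm1Printed_core_theta13OfThm1CC1_of_window (hB : (F.L : ℝ) ^ 2 ≤ B₃) (hB' : 0 ≤ B₃') (ha₀ : 0 < a₀)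
    (ha3 : ∀ K : ℕ, (143 * (((((F.P K).d + 4 : ℕ) : ℝ)) ^ 2 / 4) ^ 2) * a₀ ≤ 1 / 3)
    (ha2 : ∀ K : ℕ, 2 * a₀ ≤ 2 * deltaSU (Fin 2) / ((((F.P K).d + 4) * (F.P K).L : ℕ) : ℝ) ^ 2) (ha₁ : 0 < a₁)
    {γw : ℝ} (hγw : 0 < γw)
    (hwin : ∀ γ : ℝ, 0 < γ → γ ≤ γw → ∃ P : B12.RunParams, 1 ≤ P.K ∧
      ((coreOfRecord₁₃ F 2 (theta13OfThm1CC1 F 2 ε₀ ε₂₉ B₃ B₃' a₀ a₁)).construction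
        (densOfRecord₁₃ F 2 (theta13OfThm1CC1 F 2 ε₀ ε₂₉ B₃ B₃' a₀ a₁)) P).flow.InInterval γ P.K) :
    ¬ B16.Thm1Printed ((coreOfRecord₁₃ F 2 (theta13OfThm1CC1 F 2 ε₀ ε₂₉ B₃ B₃' a₀ a₁)).construction
      (densOfRecord₁₃ F 2 (theta13OfThm1CC1 F 2 ε₀ ε₂₉ B₃ B₃' a₀ a₁))) := by
  rintro ⟨γ, hγ, hall⟩
  have hL12 : 12 ≤ F.L := F.hL11
  have hLr : (12 : ℝ) ≤ F.L := by exact_mod_cast hL12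
  have hB0 : (0 : ℝ) ≤ B₃ := by nlinarith
  have hA : 0 < A0OfThm1CC1 F.L B₃ B₃' a₀ a₁ := A0OfThm1CC1_pos hB0 hB' ha₀ ha₁
  set γ' : ℝ := min (min γ γw) (min (1 / 2) (A0OfThm1CC1 F.L B₃ B₃' a₀ a₁ / 8)) with hγ'
  have hγ'pos : 0 < γ' := lt_min (lt_min hγ hγw) (lt_min (by norm_num) (by positivity))
  have hγ'w : γ' ≤ γw := (min_le_left _ _).trans (min_le_right _ _)
  have hγ'γ : γ' ≤ γ := (min_le_left _ _).trans (min_le_left _ _)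
  have hγ'2 : γ' ≤ 1 / 2 := (min_le_right _ _).trans (min_le_left _ _)
  have hγ'A : γ' ≤ A0OfThm1CC1 F.L B₃ B₃' a₀ a₁ / 8 := (min_le_right _ _).trans (min_le_right _ _)
  obtain ⟨P, hK, hwP⟩ := hwin γ' hγ'pos hγ'w
  have hw' : Step.InInterval γ' P.K (gOfRecord₁₃ F 2 (theta13OfThm1CC1 F 2 ε₀ ε₂₉ B₃ B₃' a₀ a₁) P) := fun k hk => hwP k hk
  have hwγ : ((coreOfRecord₁₃ F 2 (theta13OfThm1CC1 F 2 ε₀ ε₂₉ B₃ B₃' a₀ a₁)).construction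
      (densOfRecord₁₃ F 2 (theta13OfThm1CC1 F 2 ε₀ ε₂₉ B₃ B₃' a₀ a₁)) P).flow.InInterval γ P.K :=
    fun k hk => ⟨(hwP k hk).1, (hwP k hk).2.trans hγ'γ⟩
  have hS : SLaw₁₃ F 2 (theta13OfThm1CC1 F 2 ε₀ ε₂₉ B₃ B₃' a₀ a₁) P 1 := hall P hwγ 1 hK
  obtain ⟨hε₁, hc, hαε, hδ⟩ :=
    firstStepLetters_theta13OfThm1CC1_of_inInterval ε₀ ε₂₉ B₃ B₃' a₀ a₁ P hB hB' ha₀ ha₁ hγ'2 hγ'A hK hw'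
  exact not_sLaw₁₃_one_theta13OfThm1CC1 ε₀ ε₂₉ B₃ B₃' a₀ a₁ P hK ha₀ (ha3 P.K) (ha2 P.K) hε₁ hc hαε hδ hS

variable (h : (theta13OfThm1CC1 F 2 ε₀ ε₂₉ B₃ B₃' a₀ a₁).Provisos₁₃Sep F 2)

/-- **★★★ THE SAME AT THE v1.2 DATUM `datumOfRecord₁₃Sep F 2 θ₁₅ᶜᶜ¹ h`** (`rfl` on `C`). [cite: Balaban1989LargeFieldII, Thm 1 p.355; Balaban1988Convergent, Thm 1 p.262, (3.25) p.270; Balaban1985Averaging, Prop. 2 (52)–(54) p.26] -/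
theorem not_thm1Printed_theta13OfThm1CC1_of_window (hB : (F.L : ℝ) ^ 2 ≤ B₃) (hB' : 0 ≤ B₃') (ha₀ : 0 < a₀)
    (ha3 : ∀ K : ℕ, (143 * (((((F.P K).d + 4 : ℕ) : ℝ)) ^ 2 / 4) ^ 2) * a₀ ≤ 1 / 3)
    (ha2 : ∀ K : ℕ, 2 * a₀ ≤ 2 * deltaSU (Fin 2) / ((((F.P K).d + 4) * (F.P K).L : ℕ) : ℝ) ^ 2) (ha₁ : 0 < a₁)
    {γw : ℝ} (hγw : 0 < γw)
    (hwin : ∀ γ : ℝ, 0 < γ → γ ≤ γw → ∃ P : B12.RunParams, 1 ≤ P.K ∧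
      ((datumOfRecord₁₃Sep F 2 (theta13OfThm1CC1 F 2 ε₀ ε₂₉ B₃ B₃' a₀ a₁) h).C P).flow.InInterval γ P.K) :
    ¬ B16.Thm1Printed (datumOfRecord₁₃Sep F 2 (theta13OfThm1CC1 F 2 ε₀ ε₂₉ B₃ B₃' a₀ a₁) h).C :=
  not_thm1Printed_core_theta13OfThm1CC1_of_window ε₀ ε₂₉ B₃ B₃' a₀ a₁ hB hB' ha₀ ha3 ha2 ha₁ hγw hwin

/-- **★★★ THE LAST TWO CONJUNCTS OF K1⁗'s ∃-BODY ARE JOINTLY FALSE AT `θ := θ₁₅ᶜᶜ¹`** (`0 < a₀` in range on every lattice, `0 < a₁`, `L² ≤ B₃`, `0 ≤ B₃′`; any binder `h`).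
[cite: Balaban1989LargeFieldII, Thm 1 + (0.1) pp.355–356; Balaban1988Convergent, Thm 1 p.262, (3.25) p.270, (2.12) p.256; Balaban1985Averaging, Prop. 2 (52)–(54) p.26; Balaban1985Variational, Thm 1 p.279 (witness letters only)] -/
theorem not_endStatementBPrinted_and_window_theta13OfThm1CC1 (hB : (F.L : ℝ) ^ 2 ≤ B₃) (hB' : 0 ≤ B₃') (ha₀ : 0 < a₀)
    (ha3 : ∀ K : ℕ, (143 * (((((F.P K).d + 4 : ℕ) : ℝ)) ^ 2 / 4) ^ 2) * a₀ ≤ 1 / 3)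
    (ha2 : ∀ K : ℕ, 2 * a₀ ≤ 2 * deltaSU (Fin 2) / ((((F.P K).d + 4) * (F.P K).L : ℕ) : ℝ) ^ 2) (ha₁ : 0 < a₁) :
    ¬ (B16.EndStatementBPrinted (datumOfRecord₁₃Sep F 2 (theta13OfThm1CC1 F 2 ε₀ ε₂₉ B₃ B₃' a₀ a₁) h).C ∧
        ∃ γ₁ : ℝ, 0 < γ₁ ∧ ∀ γ : ℝ, 0 < γ → γ ≤ γ₁ → ∃ P : B12.RunParams, 1 ≤ P.K ∧
          ((datumOfRecord₁₃Sep F 2 (theta13OfThm1CC1 F 2 ε₀ ε₂₉ B₃ B₃' a₀ a₁) h).C P).flow.InInterval γ P.K) := by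
  rintro ⟨hE, γ₁, hγ₁, hwin⟩
  exact not_thm1Printed_theta13OfThm1CC1_of_window ε₀ ε₂₉ B₃ B₃' a₀ a₁ h hB hB' ha₀ ha3 ha2 ha₁ hγ₁ hwin hE.1

/-- **★★★ … WITH THE `d = 4` NUMERALS SPELLED**: `143·256·a₀ ≤ ⅓`, `2a₀ ≤ 2δ₂∕(8L)²`, `0 < a₀`, `0 < a₁`, `L² ≤ B₃`, `0 ≤ B₃′`.
[cite: Balaban1989LargeFieldII, Thm 1 + (0.1) pp.355–356; Balaban1988Convergent, Thm 1 p.262; Balaban1985Averaging, Prop. 2 (52)–(54) p.26; Balaban1985Variational, Thm 1 p.279 (witness letters only)] -/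
theorem not_endStatementBPrinted_and_window_theta13OfThm1CC1_d4 (hB : (F.L : ℝ) ^ 2 ≤ B₃) (hB' : 0 ≤ B₃') (ha₀ : 0 < a₀)
    (ha3 : 143 * 256 * a₀ ≤ 1 / 3) (ha2 : 2 * a₀ ≤ 2 * deltaSU (Fin 2) / ((8 * F.L : ℕ) : ℝ) ^ 2) (ha₁ : 0 < a₁) :
    ¬ (B16.EndStatementBPrinted (datumOfRecord₁₃Sep F 2 (theta13OfThm1CC1 F 2 ε₀ ε₂₉ B₃ B₃' a₀ a₁) h).C ∧
        ∃ γ₁ : ℝ, 0 < γ₁ ∧ ∀ γ : ℝ, 0 < γ → γ ≤ γ₁ → ∃ P : B12.RunParams, 1 ≤ P.K ∧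
          ((datumOfRecord₁₃Sep F 2 (theta13OfThm1CC1 F 2 ε₀ ε₂₉ B₃ B₃' a₀ a₁) h).C P).flow.InInterval γ P.K) :=
  not_endStatementBPrinted_and_window_theta13OfThm1CC1 ε₀ ε₂₉ B₃ B₃' a₀ a₁ h hB hB' ha₀ (range_hyps_of_d4 ha3 ha2).1 (range_hyps_of_d4 ha3 ha2).2 ha₁

end Summit.QuantumFields.YangMills.Theorems.BalabanUVNodesN11Thm1PrintedFailsAtThm1CC1Witness

end
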